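import Summits.QuantumFields.YangMills.Theorems.BalabanUVNodesN15CurvedGluingCubeSmoothCutDressedDefect
import Summits.QuantumFields.YangMills.Theorems.BalabanUVNodesN15CurvedGluingCubeDressedGeneralRightEntries
import HarnessLib

/-!
# Route «BalabanUVNodes» (cluster K4 «SpineRates»), Track-A DAG node N15 = NE2, BACKGROUND LAYER — THE DRESSED SMOOTH-CUT CUBE's RIGHT ENTRIES, TWO-GRID DEFECT BY NAME: file 29's two-sided defect
# `𝔇(X′∘Q′, X∘Q)` run at `G₀ := M_{χ̃}N_□` (both grids) from LEFT and RIGHT cut rows of `N_□`, their two-grid defects, bump data∕fits, nested input cut-offs (FILE 58 `hIGE` at a live background)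

Cell `pub-ymgap`, seat `pub-ymgap-dag-n15-w3` (WIDTH SEAT 3∕3 on node N15, director-ym №197 ∕ HUMAN RULING D-0149; plan `W-SEAT-START-LIST.md` §n15 item 3 «LG-vector + background layers at
GENERAL small-field U» — thirty-seventh piece: the two-grid twin of file 36).  `bears_on: R4∕N15 · K3⁷ SpineGivenEndpointR13SepCoPH (stmt-QuantumFields-20544)`.  Filed `--kind proof --supports
stmt-QuantumFields-20544 --as helper` — COUNT-NEUTRAL.  Theorems only; 0 `sorry`.  Imports BY NAME file 35 `…SmoothCutDressedDefect` (`hasMaj_idef_smoothCut_flat`, `hasMaj_idef_jet_smoothCut_flat`;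
file 34 `hasMaj_smoothCut_flat`, `hasMaj_jet_smoothCut_flat`; file 31 `smoothCut_out`, `smoothCut_in`) and file 29 `…CubeDressedGeneralRightEntries` (`hasMaj_idef_projO_dressedV_comp_loc₂`); nothing
in the tree is modified.

WHY.  FILE 58's `hIGE` row for the dressed smooth-cut cube: file 29's defect theorem wants the flat right entries `G₀∘Q`, `D_j∘Q` at both grids and their defects; at `G₀ = M_χ̃N_□` these are
file 34∕35's rows VERBATIM at `N := N_□∘Q` (associativity), fed by the RIGHT cut rows `M_χ(N_□∘Q)`, `M_χ(∇^±N_□∘Q)` and their defects.  ★★★ `hasMaj_idef_smoothCutDressed_comp_loc₂`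
(`𝔇((pr₀X̂′)∘Q′, (pr₀X̂)∘Q) ≤ 1_S1_S·C·e^{−ρ₂d}`, file 29's constant at `β̄, β̄^Q, m̄, m̄^Q`).

HONEST FRAMING ∕ LIMITS.  Pure instantiation over DISPLAYED rows at both grids; nothing of [B6]∕[B9] asserted ((2.133) p.247, (3.42) p.397 (entry 2), Thm 3.14 = SHAPES ∕ TEMPLATE).  NE2⁺ NOT
PRINTED, NOT proved; N15 NOT discharged; counts of record UNMOVED (typed 28∕28 · discharged 5∕27); one finite 𝕋⁴ at fixed ε — NOT infinite volume, NOT OS on ℝ⁴, NOT a mass gap, NOT Clay; R4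
closes the conditional finite-𝕋⁴ rung `BalabanLadder.UV` only.
-/

set_option autoImplicit false

noncomputable section
open scoped BigOperators
open Finset

namespace Summit.QuantumFields.YangMills.BalabanUVNodes.N15.CurvedSpecies

open Literature.MathematicalPhysics.QuantumFieldTheory.Balaban1983to89
open Literature.MathematicalPhysics.QuantumFieldTheory.Balaban1983to89.B11SectG (BlockNorm HasMaj RowSum)
open Literature.MathematicalPhysics.QuantumFieldTheory.Balaban1983to89.B6RandomWalk (Triangle254)
open Literature.MathematicalPhysics.QuantumFieldTheory.Balaban1983to89.T4EtaRateDefect (idef)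
open Literature.MathematicalPhysics.QuantumFieldTheory.Balaban1983to89.T4EtaRateCoeffDefect (pull)
open Literature.MathematicalPhysics.QuantumFieldTheory.Balaban1983to89.B6Prop26Gluing (mulOp mulOp_apply ind ind_nonneg)
open Summit.QuantumFields.YangMills.BalabanUVNodes.N15.MatrixSpecies (liftBlk liftMap liftEquiv liftEquiv_apply liftEquiv_symm_apply)
open Summit.QuantumFields.YangMills.BalabanUVNodes.N15.BackgroundLayer (fgrad bgrad stack projO blkPair liftPair bgPropV projO_none_comp_stack)

variable {X X' ι J : Type} [Fintype X] [Fintype X'] [DecidableEq X] [DecidableEq X'] [Fintype ι] [DecidableEq ι] [Fintype J] [DecidableEq J] {g : B6.Geometry}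
  (blk : X → g.Site) (π : X' → X) (τ : J → X ≃ X) (τ' : J → X' ≃ X') (n n' : ℝ) {σ cr : ℝ}
  {N : (X × ι → ℝ) →ₗ[ℝ] (X × ι → ℝ)} {N' : (X' × ι → ℝ) →ₗ[ℝ] (X' × ι → ℝ)} {V : ((X × ι) × Option (J ⊕ J) → ℝ) →ₗ[ℝ] (X × ι → ℝ)}
  {V' : ((X' × ι) × Option (J ⊕ J) → ℝ) →ₗ[ℝ] (X' × ι → ℝ)} {χX χtX ψX ψ₂X : X → ℝ} {χX' χtX' ψX' ψ₂X' : X' → ℝ} {S : Set g.Site} {β β₁ βQ βQ₁ ct m₀ m₁ mQ₀ mQ₁ oχ o₁ o₂ δ : ℝ}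

/-- ★★★ **THE TWO-GRID DEFECT OF A RIGHT ENTRY OF THE DRESSED SMOOTH-CUT CUBE, TWO-SIDED** (FILE 58 `hIGE` at a live background): everything of file 35's ★★★ (cut rows `β, β₁` + defects `m₀, m₁`,
bump data and fits, input cut-offs, `V̂, V̂′` + fit) plus right factors `Q, Q′` with nested cut-offs `M_ψQM_{ψ₂} = M_ψQ` (both grids) and the RIGHT cut rows `M_χ(N∘Q)` (`β^Q`), `M_χ(∇^±N∘Q)` (`β^Q₁`)
with defects `m^Q₀, m^Q₁` ⟹ `𝔇((pr₀X̂′)∘Q′, (pr₀X̂)∘Q) ≤ 1_S1_S·C·e^{−ρ₂d}` with file 29's constant at `β := β̄`, `β₂ := β̄^Q`, `m_G := m̄`, `m_Q := m̄^Q`.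
[cite: Balaban1985BackgroundPropagators, (3.42) p.397 (entry 2), Thm 3.14 pp.426–427 (template); Balaban1984PropagatorsII, (2.133) p.247] -/
theorem hasMaj_idef_smoothCutDressed_comp_loc₂ (htri : Triangle254 g) (hd : ∀ a b : g.Site, 0 ≤ g.dist a b) (hrow : RowSum g σ cr) (hσ : 0 ≤ σ) (hcr : 0 ≤ cr) {ρ₁ ρ₂ δV R o : ℝ}
    (hβ : 0 ≤ β) (hβ₁ : 0 ≤ β₁) (hct : 0 ≤ ct) (hm₀ : 0 ≤ m₀) (hm₁ : 0 ≤ m₁) (hoχ : 0 ≤ oχ) (ho₁ : 0 ≤ o₁) (ho₂ : 0 ≤ o₂) (hR : 0 ≤ R) (ho : 0 ≤ o) (hσρ : σ ≤ ρ₁)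
    (hρ₁V : ρ₁ ≤ δV) (hρ₁G : ρ₁ + σ ≤ δ) (hρ₂ : 0 ≤ ρ₂) (hρ₂₁ : ρ₂ + σ ≤ ρ₁)
    -- supports of the cuts over `S`, both grids
    (hSχ : ∀ x, χX x ≠ 0 → blk x ∈ S) (hSψ₂ : ∀ x, ψ₂X x ≠ 0 → blk x ∈ S) (hSχ' : ∀ x', χX' x' ≠ 0 → blk (π x') ∈ S) (hSψ₂' : ∀ x', ψ₂X' x' ≠ 0 → blk (π x') ∈ S)
    -- coarse bump data
    (hχt : ∀ x, |χtX x| ≤ 1)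
    (hdχt : ∀ μ p, |fgrad n (liftEquiv (τ μ) ι) (fun p : X × ι => χtX p.1) p| ≤ ct) (hdχtb : ∀ μ p, |bgrad n (liftEquiv (τ μ) ι) (fun p : X × ι => χtX p.1) p| ≤ ct)
    (hsub : mulOp (fun p : X × ι => χtX p.1) ∘ₗ mulOp (fun p : X × ι => χX p.1) = mulOp (fun p : X × ι => χtX p.1))
    (hχ : mulOp (fun p : X × ι => χX p.1) ∘ₗ mulOp (fun p : X × ι => χtX p.1) = mulOp (fun p : X × ι => χtX p.1))
    (hs : ∀ μ, mulOp ((fun p : X × ι => χtX p.1) ∘ (liftEquiv (τ μ) ι)) ∘ₗ mulOp (fun p : X × ι => χX p.1) = mulOp ((fun p : X × ι => χtX p.1) ∘ (liftEquiv (τ μ) ι)))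
    (hsb : ∀ μ, mulOp ((fun p : X × ι => χtX p.1) ∘ (liftEquiv (τ μ) ι).symm) ∘ₗ mulOp (fun p : X × ι => χX p.1) = mulOp ((fun p : X × ι => χtX p.1) ∘ (liftEquiv (τ μ) ι).symm))
    (hdd : ∀ μ, mulOp (fgrad n (liftEquiv (τ μ) ι) (fun p : X × ι => χtX p.1)) ∘ₗ mulOp (fun p : X × ι => χX p.1) = mulOp (fgrad n (liftEquiv (τ μ) ι) (fun p : X × ι => χtX p.1)))
    (hddb : ∀ μ, mulOp (bgrad n (liftEquiv (τ μ) ι) (fun p : X × ι => χtX p.1)) ∘ₗ mulOp (fun p : X × ι => χX p.1) = mulOp (bgrad n (liftEquiv (τ μ) ι) (fun p : X × ι => χtX p.1)))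
    (hNψ : N ∘ₗ mulOp (fun p : X × ι => ψX p.1) = N)
    -- fine bump data
    (hχt' : ∀ x', |χtX' x'| ≤ 1)
    (hdχt' : ∀ μ p', |fgrad n' (liftEquiv (τ' μ) ι) (fun p' : X' × ι => χtX' p'.1) p'| ≤ ct) (hdχtb' : ∀ μ p', |bgrad n' (liftEquiv (τ' μ) ι) (fun p' : X' × ι => χtX' p'.1) p'| ≤ ct)
    (hsub' : mulOp (fun p : X' × ι => χtX' p.1) ∘ₗ mulOp (fun p : X' × ι => χX' p.1) = mulOp (fun p : X' × ι => χtX' p.1))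
    (hχ' : mulOp (fun p : X' × ι => χX' p.1) ∘ₗ mulOp (fun p : X' × ι => χtX' p.1) = mulOp (fun p : X' × ι => χtX' p.1))
    (hs' : ∀ μ, mulOp ((fun p' : X' × ι => χtX' p'.1) ∘ (liftEquiv (τ' μ) ι)) ∘ₗ mulOp (fun p' : X' × ι => χX' p'.1) = mulOp ((fun p' : X' × ι => χtX' p'.1) ∘ (liftEquiv (τ' μ) ι)))
    (hsb' : ∀ μ, mulOp ((fun p' : X' × ι => χtX' p'.1) ∘ (liftEquiv (τ' μ) ι).symm) ∘ₗ mulOp (fun p' : X' × ι => χX' p'.1) =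
      mulOp ((fun p' : X' × ι => χtX' p'.1) ∘ (liftEquiv (τ' μ) ι).symm))
    (hdd' : ∀ μ, mulOp (fgrad n' (liftEquiv (τ' μ) ι) (fun p' : X' × ι => χtX' p'.1)) ∘ₗ mulOp (fun p' : X' × ι => χX' p'.1) = mulOp (fgrad n' (liftEquiv (τ' μ) ι) (fun p' : X' × ι => χtX' p'.1)))
    (hddb' : ∀ μ, mulOp (bgrad n' (liftEquiv (τ' μ) ι) (fun p' : X' × ι => χtX' p'.1)) ∘ₗ mulOp (fun p' : X' × ι => χX' p'.1) = mulOp (bgrad n' (liftEquiv (τ' μ) ι) (fun p' : X' × ι => χtX' p'.1)))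
    (hNψ' : N' ∘ₗ mulOp (fun p : X' × ι => ψX' p.1) = N')
    -- fits of the bumps across `π`
    (hfitχ : ∀ x', |χtX' x' - χtX (π x')| ≤ oχ)
    (hfit₁ : ∀ μ p', |((fun p' : X' × ι => χtX' p'.1) ∘ (liftEquiv (τ' μ) ι)) p' - ((fun p : X × ι => χtX p.1) ∘ (liftEquiv (τ μ) ι)) (liftMap π ι p')| ≤ o₁)
    (hfit₁b : ∀ μ p', |((fun p' : X' × ι => χtX' p'.1) ∘ (liftEquiv (τ' μ) ι).symm) p' - ((fun p : X × ι => χtX p.1) ∘ (liftEquiv (τ μ) ι).symm) (liftMap π ι p')| ≤ o₁)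
    (hfit₂ : ∀ μ p', |fgrad n' (liftEquiv (τ' μ) ι) (fun p' : X' × ι => χtX' p'.1) p' - fgrad n (liftEquiv (τ μ) ι) (fun p : X × ι => χtX p.1) (liftMap π ι p')| ≤ o₂)
    (hfit₂b : ∀ μ p', |bgrad n' (liftEquiv (τ' μ) ι) (fun p' : X' × ι => χtX' p'.1) p' - bgrad n (liftEquiv (τ μ) ι) (fun p : X × ι => χtX p.1) (liftMap π ι p')| ≤ o₂)
    -- cut rows and their defects
    (hcut : HasMaj (BlockNorm.ofBlocks g (liftBlk blk ι)) (BlockNorm.ofBlocks g (liftBlk blk ι)) (mulOp (fun p : X × ι => χX p.1) ∘ₗ N)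
      (fun y y' => ind S y * ind S y' * (β * Real.exp (-(δ * g.dist y y')))))
    (hcutF : ∀ μ, HasMaj (BlockNorm.ofBlocks g (liftBlk blk ι)) (BlockNorm.ofBlocks g (liftBlk blk ι)) (mulOp (fun p : X × ι => χX p.1) ∘ₗ (fgrad n (liftEquiv (τ μ) ι) ∘ₗ N))
      (fun y y' => ind S y * ind S y' * (β₁ * Real.exp (-(δ * g.dist y y')))))
    (hcutB : ∀ μ, HasMaj (BlockNorm.ofBlocks g (liftBlk blk ι)) (BlockNorm.ofBlocks g (liftBlk blk ι)) (mulOp (fun p : X × ι => χX p.1) ∘ₗ (bgrad n (liftEquiv (τ μ) ι) ∘ₗ N))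
      (fun y y' => ind S y * ind S y' * (β₁ * Real.exp (-(δ * g.dist y y')))))
    (hcut' : HasMaj (BlockNorm.ofBlocks g (liftBlk (blk ∘ π) ι)) (BlockNorm.ofBlocks g (liftBlk (blk ∘ π) ι)) (mulOp (fun p : X' × ι => χX' p.1) ∘ₗ N')
      (fun y y' => ind S y * ind S y' * (β * Real.exp (-(δ * g.dist y y')))))
    (hcutF' : ∀ μ, HasMaj (BlockNorm.ofBlocks g (liftBlk (blk ∘ π) ι)) (BlockNorm.ofBlocks g (liftBlk (blk ∘ π) ι)) (mulOp (fun p : X' × ι => χX' p.1) ∘ₗ (fgrad n' (liftEquiv (τ' μ) ι) ∘ₗ N'))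
      (fun y y' => ind S y * ind S y' * (β₁ * Real.exp (-(δ * g.dist y y')))))
    (hcutB' : ∀ μ, HasMaj (BlockNorm.ofBlocks g (liftBlk (blk ∘ π) ι)) (BlockNorm.ofBlocks g (liftBlk (blk ∘ π) ι)) (mulOp (fun p : X' × ι => χX' p.1) ∘ₗ (bgrad n' (liftEquiv (τ' μ) ι) ∘ₗ N'))
      (fun y y' => ind S y * ind S y' * (β₁ * Real.exp (-(δ * g.dist y y')))))
    (hDcut : HasMaj (BlockNorm.ofBlocks g (liftBlk blk ι)) (BlockNorm.ofBlocks g (liftBlk blk ι ∘ liftMap π ι))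
      (idef (pull (liftMap π ι)) (pull (liftMap π ι)) (mulOp (fun p : X' × ι => χX' p.1) ∘ₗ N') (mulOp (fun p : X × ι => χX p.1) ∘ₗ N))
      (fun y y' => ind S y * ind S y' * (m₀ * Real.exp (-(δ * g.dist y y')))))
    (hDcutF : ∀ μ, HasMaj (BlockNorm.ofBlocks g (liftBlk blk ι)) (BlockNorm.ofBlocks g (liftBlk blk ι ∘ liftMap π ι))
      (idef (pull (liftMap π ι)) (pull (liftMap π ι)) (mulOp (fun p : X' × ι => χX' p.1) ∘ₗ (fgrad n' (liftEquiv (τ' μ) ι) ∘ₗ N')) (mulOp (fun p : X × ι => χX p.1) ∘ₗ (fgrad n (liftEquiv (τ μ) ι) ∘ₗ N)))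
      (fun y y' => ind S y * ind S y' * (m₁ * Real.exp (-(δ * g.dist y y')))))
    (hDcutB : ∀ μ, HasMaj (BlockNorm.ofBlocks g (liftBlk blk ι)) (BlockNorm.ofBlocks g (liftBlk blk ι ∘ liftMap π ι))
      (idef (pull (liftMap π ι)) (pull (liftMap π ι)) (mulOp (fun p : X' × ι => χX' p.1) ∘ₗ (bgrad n' (liftEquiv (τ' μ) ι) ∘ₗ N')) (mulOp (fun p : X × ι => χX p.1) ∘ₗ (bgrad n (liftEquiv (τ μ) ι) ∘ₗ N)))
      (fun y y' => ind S y * ind S y' * (m₁ * Real.exp (-(δ * g.dist y y')))))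
    -- the perturbation at both grids
    (hV : HasMaj (BlockNorm.ofBlocks g (blkPair (liftBlk blk ι))) (BlockNorm.ofBlocks g (liftBlk blk ι)) V (fun y y' => R * Real.exp (-(δV * g.dist y y'))))
    (hV' : HasMaj (BlockNorm.ofBlocks g (blkPair (liftBlk (blk ∘ π) ι))) (BlockNorm.ofBlocks g (liftBlk (blk ∘ π) ι)) V' (fun y y' => R * Real.exp (-(δV * g.dist y y'))))
    (hDV : HasMaj (BlockNorm.ofBlocks g (blkPair (liftBlk blk ι))) (BlockNorm.ofBlocks g (liftBlk (blk ∘ π) ι))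
      (idef (pull (liftPair (liftMap π ι))) (pull (liftMap π ι)) V' V) (fun y y' => o * Real.exp (-(δV * g.dist y y'))))
    -- right factors `Q, Q′`: nested input cut-offs and RIGHT cut rows (coarse; the fine ones enter only through the defects) with their defects
    (Q : (X × ι → ℝ) →ₗ[ℝ] (X × ι → ℝ)) (Q' : (X' × ι → ℝ) →ₗ[ℝ] (X' × ι → ℝ))
    (hQ : mulOp (fun p : X × ι => ψX p.1) ∘ₗ Q ∘ₗ mulOp (fun p : X × ι => ψ₂X p.1) = mulOp (fun p : X × ι => ψX p.1) ∘ₗ Q)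
    (hQ' : mulOp (fun p : X' × ι => ψX' p.1) ∘ₗ Q' ∘ₗ mulOp (fun p : X' × ι => ψ₂X' p.1) = mulOp (fun p : X' × ι => ψX' p.1) ∘ₗ Q')
    (hβQ : 0 ≤ βQ) (hβQ₁ : 0 ≤ βQ₁) (hmQ₀ : 0 ≤ mQ₀) (hmQ₁ : 0 ≤ mQ₁)
    (hcutQ : HasMaj (BlockNorm.ofBlocks g (liftBlk blk ι)) (BlockNorm.ofBlocks g (liftBlk blk ι)) (mulOp (fun p : X × ι => χX p.1) ∘ₗ (N ∘ₗ Q))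
      (fun y y' => ind S y * ind S y' * (βQ * Real.exp (-(δ * g.dist y y')))))
    (hcutFQ : ∀ μ, HasMaj (BlockNorm.ofBlocks g (liftBlk blk ι)) (BlockNorm.ofBlocks g (liftBlk blk ι)) (mulOp (fun p : X × ι => χX p.1) ∘ₗ (fgrad n (liftEquiv (τ μ) ι) ∘ₗ (N ∘ₗ Q)))
      (fun y y' => ind S y * ind S y' * (βQ₁ * Real.exp (-(δ * g.dist y y')))))
    (hcutBQ : ∀ μ, HasMaj (BlockNorm.ofBlocks g (liftBlk blk ι)) (BlockNorm.ofBlocks g (liftBlk blk ι)) (mulOp (fun p : X × ι => χX p.1) ∘ₗ (bgrad n (liftEquiv (τ μ) ι) ∘ₗ (N ∘ₗ Q)))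
      (fun y y' => ind S y * ind S y' * (βQ₁ * Real.exp (-(δ * g.dist y y')))))
    (hDcutQ : HasMaj (BlockNorm.ofBlocks g (liftBlk blk ι)) (BlockNorm.ofBlocks g (liftBlk blk ι ∘ liftMap π ι))
      (idef (pull (liftMap π ι)) (pull (liftMap π ι)) (mulOp (fun p : X' × ι => χX' p.1) ∘ₗ (N' ∘ₗ Q')) (mulOp (fun p : X × ι => χX p.1) ∘ₗ (N ∘ₗ Q)))
      (fun y y' => ind S y * ind S y' * (mQ₀ * Real.exp (-(δ * g.dist y y')))))
    (hDcutFQ : ∀ μ, HasMaj (BlockNorm.ofBlocks g (liftBlk blk ι)) (BlockNorm.ofBlocks g (liftBlk blk ι ∘ liftMap π ι))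
      (idef (pull (liftMap π ι)) (pull (liftMap π ι)) (mulOp (fun p : X' × ι => χX' p.1) ∘ₗ (fgrad n' (liftEquiv (τ' μ) ι) ∘ₗ (N' ∘ₗ Q'))) (mulOp (fun p : X × ι => χX p.1) ∘ₗ (fgrad n (liftEquiv (τ μ) ι) ∘ₗ (N ∘ₗ Q))))
      (fun y y' => ind S y * ind S y' * (mQ₁ * Real.exp (-(δ * g.dist y y')))))
    (hDcutBQ : ∀ μ, HasMaj (BlockNorm.ofBlocks g (liftBlk blk ι)) (BlockNorm.ofBlocks g (liftBlk blk ι ∘ liftMap π ι))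
      (idef (pull (liftMap π ι)) (pull (liftMap π ι)) (mulOp (fun p : X' × ι => χX' p.1) ∘ₗ (bgrad n' (liftEquiv (τ' μ) ι) ∘ₗ (N' ∘ₗ Q'))) (mulOp (fun p : X × ι => χX p.1) ∘ₗ (bgrad n (liftEquiv (τ μ) ι) ∘ₗ (N ∘ₗ Q))))
      (fun y y' => ind S y * ind S y' * (mQ₁ * Real.exp (-(δ * g.dist y y')))))
    (hq : (β + (β₁ + ct * β)) * (R * cr) * cr < 1) :
    HasMaj (BlockNorm.ofBlocks g (liftBlk blk ι)) (BlockNorm.ofBlocks g (liftBlk (blk ∘ π) ι))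
      (idef (pull (liftMap π ι)) (pull (liftMap π ι))
        ((projO none ∘ₗ bgPropV (stack (mulOp (fun p : X' × ι => χtX' p.1) ∘ₗ N')
          (fun j => Sum.elim (fun μ => fgrad n' (liftEquiv (τ' μ) ι)) (fun μ => bgrad n' (liftEquiv (τ' μ) ι)) j ∘ₗ (mulOp (fun p : X' × ι => χtX' p.1) ∘ₗ N'))) V') ∘ₗ Q')
        ((projO none ∘ₗ bgPropV (stack (mulOp (fun p : X × ι => χtX p.1) ∘ₗ N)
          (fun j => Sum.elim (fun μ => fgrad n (liftEquiv (τ μ) ι)) (fun μ => bgrad n (liftEquiv (τ μ) ι)) j ∘ₗ (mulOp (fun p : X × ι => χtX p.1) ∘ₗ N))) V) ∘ₗ Q))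
      (fun y y' => ind S y * ind S y' *
        ((((mQ₀ + oχ * βQ) + (mQ₁ + o₁ * βQ₁ + ct * mQ₀ + o₂ * βQ)) * cr +
              ((m₀ + oχ * β) + (m₁ + o₁ * β₁ + ct * m₀ + o₂ * β)) * cr *
                (R * ((βQ + (βQ₁ + ct * βQ)) * (1 - (β + (β₁ + ct * β)) * (R * cr) * cr)⁻¹) * cr) +
            (β + (β₁ + ct * β)) * o * cr * ((βQ + (βQ₁ + ct * βQ)) * (1 - (β + (β₁ + ct * β)) * (R * cr) * cr)⁻¹) * cr) *
          (1 - (β + (β₁ + ct * β)) * (R * cr) * cr)⁻¹ * Real.exp (-(ρ₂ * g.dist y y')))) := by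
  have hβb : 0 ≤ β + (β₁ + ct * β) := by positivity
  have hβQb : 0 ≤ βQ + (βQ₁ + ct * βQ) := by positivity
  have hmb : 0 ≤ (m₀ + oχ * β) + (m₁ + o₁ * β₁ + ct * m₀ + o₂ * β) := by positivity
  have hmQb : 0 ≤ (mQ₀ + oχ * βQ) + (mQ₁ + o₁ * βQ₁ + ct * mQ₀ + o₂ * βQ) := by positivity
  have hG := hasMaj_smoothCut_flat blk (S := S) hβ hβ₁ hct hχt hsub hcut
  have hD := hasMaj_jet_smoothCut_flat blk τ n (S := S) hβ hβ₁ hct hχt hdχt hdχtb hs hsb hdd hddb hcut hcutF hcutB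
  have hG' := hasMaj_smoothCut_flat (blk ∘ π) (S := S) hβ hβ₁ hct hχt' hsub' hcut'
  have hD' := hasMaj_jet_smoothCut_flat (blk ∘ π) τ' n' (S := S) hβ hβ₁ hct hχt' hdχt' hdχtb' hs' hsb' hdd' hddb' hcut' hcutF' hcutB'
  have hDG := hasMaj_idef_smoothCut_flat blk π (S := S) (N := N) (N' := N') hβ hβ₁ hct hm₀ hm₁ hoχ ho₁ ho₂ hχt' hfitχ hsub hsub' hcut hDcut
  have hDD := hasMaj_idef_jet_smoothCut_flat blk π τ τ' n n' (S := S) (N := N) (N' := N') hβ hβ₁ hct hm₀ hm₁ hoχ ho₁ ho₂ hχt' hdχt' hdχtb' hfit₁ hfit₁b hfit₂ hfit₂b hs hsb hdd hddb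
    hs' hsb' hdd' hddb' hcut hcutF hcutB hDcut hDcutF hDcutB
  -- the flat right entries and their defects, at `N := N∘Q`
  have hGQ : HasMaj (BlockNorm.ofBlocks g (liftBlk blk ι)) (BlockNorm.ofBlocks g (liftBlk blk ι)) ((mulOp (fun p : X × ι => χtX p.1) ∘ₗ N) ∘ₗ Q)
      (fun y y' => (βQ + (βQ₁ + ct * βQ)) * Real.exp (-(δ * g.dist y y'))) := by
    rw [LinearMap.comp_assoc]; exact hasMaj_smoothCut_flat blk (S := S) hβQ hβQ₁ hct hχt hsub hcutQ
  have hDQ : ∀ j : J ⊕ J, HasMaj (BlockNorm.ofBlocks g (liftBlk blk ι)) (BlockNorm.ofBlocks g (liftBlk blk ι))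
      ((Sum.elim (fun μ => fgrad n (liftEquiv (τ μ) ι)) (fun μ => bgrad n (liftEquiv (τ μ) ι)) j ∘ₗ (mulOp (fun p : X × ι => χtX p.1) ∘ₗ N)) ∘ₗ Q)
      (fun y y' => (βQ + (βQ₁ + ct * βQ)) * Real.exp (-(δ * g.dist y y'))) := fun j => by
    rw [LinearMap.comp_assoc, LinearMap.comp_assoc]
    exact hasMaj_jet_smoothCut_flat blk τ n (S := S) hβQ hβQ₁ hct hχt hdχt hdχtb hs hsb hdd hddb hcutQ hcutFQ hcutBQ j
  have hDGQ : HasMaj (BlockNorm.ofBlocks g (liftBlk blk ι)) (BlockNorm.ofBlocks g (liftBlk (blk ∘ π) ι))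
      (idef (pull (liftMap π ι)) (pull (liftMap π ι)) ((mulOp (fun p : X' × ι => χtX' p.1) ∘ₗ N') ∘ₗ Q') ((mulOp (fun p : X × ι => χtX p.1) ∘ₗ N) ∘ₗ Q))
      (fun y y' => ((mQ₀ + oχ * βQ) + (mQ₁ + o₁ * βQ₁ + ct * mQ₀ + o₂ * βQ)) * Real.exp (-(δ * g.dist y y'))) := by
    rw [LinearMap.comp_assoc, LinearMap.comp_assoc]
    exact hasMaj_idef_smoothCut_flat blk π (S := S) (N := N ∘ₗ Q) (N' := N' ∘ₗ Q') hβQ hβQ₁ hct hmQ₀ hmQ₁ hoχ ho₁ ho₂ hχt' hfitχ hsub hsub' hcutQ hDcutQ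
  have hDDQ : ∀ j : J ⊕ J, HasMaj (BlockNorm.ofBlocks g (liftBlk blk ι)) (BlockNorm.ofBlocks g (liftBlk (blk ∘ π) ι))
      (idef (pull (liftMap π ι)) (pull (liftMap π ι))
        ((Sum.elim (fun μ => fgrad n' (liftEquiv (τ' μ) ι)) (fun μ => bgrad n' (liftEquiv (τ' μ) ι)) j ∘ₗ (mulOp (fun p : X' × ι => χtX' p.1) ∘ₗ N')) ∘ₗ Q')
        ((Sum.elim (fun μ => fgrad n (liftEquiv (τ μ) ι)) (fun μ => bgrad n (liftEquiv (τ μ) ι)) j ∘ₗ (mulOp (fun p : X × ι => χtX p.1) ∘ₗ N)) ∘ₗ Q))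
      (fun y y' => ((mQ₀ + oχ * βQ) + (mQ₁ + o₁ * βQ₁ + ct * mQ₀ + o₂ * βQ)) * Real.exp (-(δ * g.dist y y'))) := fun j => by
    rw [LinearMap.comp_assoc, LinearMap.comp_assoc, LinearMap.comp_assoc, LinearMap.comp_assoc]
    exact hasMaj_idef_jet_smoothCut_flat blk π τ τ' n n' (S := S) (N := N ∘ₗ Q) (N' := N' ∘ₗ Q') hβQ hβQ₁ hct hmQ₀ hmQ₁ hoχ ho₁ ho₂ hχt' hdχt' hdχtb' hfit₁ hfit₁b hfit₂ hfit₂b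
      hs hsb hdd hddb hs' hsb' hdd' hddb' hcutQ hcutFQ hcutBQ hDcutQ hDcutFQ hDcutBQ j
  have hχ0 : mulOp (fun p : X × ι => χX p.1) ∘ₗ (projO none ∘ₗ stack (mulOp (fun p : X × ι => χtX p.1) ∘ₗ N)
      (fun j => Sum.elim (fun μ => fgrad n (liftEquiv (τ μ) ι)) (fun μ => bgrad n (liftEquiv (τ μ) ι)) j ∘ₗ (mulOp (fun p : X × ι => χtX p.1) ∘ₗ N))) =
      projO none ∘ₗ stack (mulOp (fun p : X × ι => χtX p.1) ∘ₗ N)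
        (fun j => Sum.elim (fun μ => fgrad n (liftEquiv (τ μ) ι)) (fun μ => bgrad n (liftEquiv (τ μ) ι)) j ∘ₗ (mulOp (fun p : X × ι => χtX p.1) ∘ₗ N)) := by
    rw [projO_none_comp_stack]; exact smoothCut_out hχ
  have hχ0' : mulOp (fun p : X' × ι => χX' p.1) ∘ₗ (projO none ∘ₗ stack (mulOp (fun p : X' × ι => χtX' p.1) ∘ₗ N')
      (fun j => Sum.elim (fun μ => fgrad n' (liftEquiv (τ' μ) ι)) (fun μ => bgrad n' (liftEquiv (τ' μ) ι)) j ∘ₗ (mulOp (fun p : X' × ι => χtX' p.1) ∘ₗ N'))) =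
      projO none ∘ₗ stack (mulOp (fun p : X' × ι => χtX' p.1) ∘ₗ N')
        (fun j => Sum.elim (fun μ => fgrad n' (liftEquiv (τ' μ) ι)) (fun μ => bgrad n' (liftEquiv (τ' μ) ι)) j ∘ₗ (mulOp (fun p : X' × ι => χtX' p.1) ∘ₗ N')) := by
    rw [projO_none_comp_stack]; exact smoothCut_out hχ'
  have key := hasMaj_idef_projO_dressedV_comp_loc₂ blk π htri hd hrow hσ hcr hβb hβQb hR ho hmb hmQb hσρ hρ₁V hρ₁G hρ₂ hρ₂₁ (fun _ => rfl) (fun _ => rfl) none Q Q' hSχ hSψ₂ hSχ' hSψ₂'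
    hχ0 (smoothCut_in hNψ) hQ hχ0' (smoothCut_in hNψ') hQ' hG hD hG' hD' hDG hDD hGQ hDQ hDGQ hDDQ hV hV' hDV hq
  refine key.mono fun y y' => le_of_eq ?_
  ring

end Summit.QuantumFields.YangMills.BalabanUVNodes.N15.CurvedSpecies

end
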